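import Summits.BirchSwinnertonDyer.BirchSwinnertonDyer.Theorems.CyclotomicUntwistPSUntwistedTraceInvariance
import Literature.NumberTheory.EllipticCurves.QuadraticTwist
import HarnessLib

/-!
# LAW L-a3 (C), model-free: `a_w(E^{(−3)}) = a_w(E)`, `a_w(E^{(−1)}) = −a_w(E)`, `a_w(E^{(3)}) = −a_w(E)` for EVERY
# Weierstrass equation over `ℚ` (route `CyclotomicUntwist`, cruxes K1 `PSRankOneLowerHalfAtThree` / K2)

Cell `pub/bsd-wall` (D-0145 line `route-BirchSwinnertonDyer-CyclotomicUntwist`), seat `bsd-line-cycu-p3` (gen 6).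
Helper toward K1 (stmt-BirchSwinnertonDyer-21580) / K2 (stmt-21581). THEOREMS ONLY (no definition, no named fact,
no `sorry`); BSD is not proved by this file and no crux is.

`CyclotomicUntwistPSUntwistedTraceTwist` (p618633) proved the twist laws of the untwisted trace `a_w` on the
principal-series ROWS, for globally minimal models, in the currency `C • V^{(±3)} = W` of LAW L-tw3. With the residue API
of `CyclotomicUntwistPSUntwistedTraceInvariance` (p620627) the laws hold for the closed form ITSELF, on every equation:

* `primeToThreePart_neg`, `primeToThreePart_three_pow_mul`, `res9_neg` (`res9 (−x) = (−res9 x) mod 9`),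
  `res9_three_pow_mul` (`res9 (3ᵏx) = res9 x`); `signNine_neg_emod_of_mem`, `traceTableIV_neg_emod_of_mem`
  (the tables are odd under `r ↦ −r mod 9`, junk classes included);
* **`untwistedTraceOfInvariants_neg`**: `a(−c₆, Δ) = −a(c₆, Δ)` (all `c₆, Δ`);
  **`untwistedTraceOfInvariants_negTwentySeven_mul`**: `a(−27c₆, 729Δ) = a(c₆, Δ)` (`Δ ≠ 0`);
* **`psUntwistedTrace_quadraticTwist_neg_one`**: `(W^{(−1)}).psUntwistedTrace = −W.psUntwistedTrace` (every `W`);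
  **`psUntwistedTrace_quadraticTwist_neg_three`**: `(W^{(−3)}).psUntwistedTrace = W.psUntwistedTrace` (`Δ ≠ 0`);
  **`psUntwistedTrace_quadraticTwist_three`**: `(W^{(3)}).psUntwistedTrace = −W.psUntwistedTrace` (`Δ ≠ 0`)
  (`W.quadraticTwist d` of `Literature.NumberTheory.EllipticCurves.QuadraticTwist`: `c₆ ↦ d³c₆`, `Δ ↦ d⁶Δ`).

Informal reading (LAW-La3-KERNEL-v3 (C), not asserted): `E ≅ E^{(−3)}` over `ℚ₃(ζ₉) ∋ √−3`, so the special fibre and its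
trace are unchanged; `E^{(−1)}` and `E^{(3)}` become the unramified quadratic twist over `ℚ₃(ζ₉)`, negating the trace.

References: A. Kraus, Manuscripta Math. 69 (1990) [Kraus1990]; J. H. Silverman, *AEC* X.2 Prop. 2.4 [SilvermanAEC2009];
O. G. Rizzo, Compositio Math. 136 (2003) §1.1–1.2 [Rizzo2003].
-/

set_option autoImplicit false
-- single-conjunct summit: `Summit.BirchSwinnertonDyer.BirchSwinnertonDyer.…` repeats the name by design
set_option linter.dupNamespace false

open Literature.NumberTheory.EllipticCurves WeierstrassCurve

namespace Summit.BirchSwinnertonDyer.BirchSwinnertonDyer.Theorems.PSUntwistedTrace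

/-! ### `res9` under negation and multiplication by powers of `3` -/

section Res9

/-- `(−x)′ = −x′`. [cite: Rizzo2003, p. 2 (notation x')] -/
theorem primeToThreePart_neg (x : ℚ) : Rizzo.primeToThreePart (-x) = -Rizzo.primeToThreePart x := by
  unfold Rizzo.primeToThreePart
  rw [padicValRat.neg, neg_div]

/-- `(3ᵏ·x)′ = x′` for `x ≠ 0`. [cite: Rizzo2003, p. 2 (notation x')] -/
theorem primeToThreePart_three_pow_mul {x : ℚ} (hx : x ≠ 0) (k : ℕ) :
    Rizzo.primeToThreePart (3 ^ k * x) = Rizzo.primeToThreePart x := by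
  unfold Rizzo.primeToThreePart
  have h33 : padicValRat 3 (3 : ℚ) = 1 := by
    have := @padicValRat.self 3 (by norm_num)
    simpa using this
  rw [padicValRat.mul (pow_ne_zero _ (by norm_num)) hx, padicValRat.pow, h33, mul_one,
    zpow_add₀ (by norm_num : (3 : ℚ) ≠ 0), zpow_natCast]
  field_simp

/-- **`res9 (−x) = (−res9 x) mod 9`** (numerator negated, denominator kept). [cite: Rizzo2003, p. 2 (notation x')] -/
theorem res9_neg (x : ℚ) : Rizzo.res9 (-x) = (-Rizzo.res9 x) % 9 := by
  have hx := res9_mem_Ico x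
  have hnx := res9_mem_Ico (-x)
  have hcast : ((Rizzo.res9 (-x) : ℤ) : ZMod 9) = (((-Rizzo.res9 x) % 9 : ℤ) : ZMod 9) := by
    rw [intCast_emod_nine, Int.cast_neg, res9_cast, res9_cast, primeToThreePart_neg, Rat.num_neg_eq_neg_num,
      Rat.den_neg_eq_den, Int.cast_neg, neg_mul]
  have := (ZMod.intCast_eq_intCast_iff _ _ 9).mp hcast
  unfold Int.ModEq at this
  omega

/-- **`res9 (3ᵏ·x) = res9 x`**. [cite: Rizzo2003, p. 2 (notation x')] -/
theorem res9_three_pow_mul (x : ℚ) (k : ℕ) : Rizzo.res9 (3 ^ k * x) = Rizzo.res9 x := by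
  by_cases hx : x = 0
  · subst hx; simp
  unfold Rizzo.res9
  rw [primeToThreePart_three_pow_mul hx]

/-- `s((−r) mod 9) = −s(r)` for `0 ≤ r < 9` (junk classes included). [folklore] -/
theorem signNine_neg_emod_of_mem {r : ℤ} (h0 : 0 ≤ r) (h9 : r < 9) : signNine ((-r) % 9) = -signNine r := by
  interval_cases r <;> decide

/-- `T((−r) mod 9) = −T(r)` for `0 ≤ r < 9` (junk classes included). [folklore] -/
theorem traceTableIV_neg_emod_of_mem {r : ℤ} (h0 : 0 ≤ r) (h9 : r < 9) :
    traceTableIV ((-r) % 9) = -traceTableIV r := by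
  interval_cases r <;> decide

end Res9

/-! ### The closed form under `c₆ ↦ −c₆` and `(c₆, Δ) ↦ (−27c₆, 729Δ)` -/

section ClosedForm

/-- **`a(−c₆, Δ) = −a(c₆, Δ)`** for the closed form (N′), all `c₆, Δ`: the `χ₋₁`-twist at the level of invariants
(`c₆ ↦ −c₆`, `Δ ↦ Δ`). [cite: Kraus1990, Théorème (p = 3)] -/
theorem untwistedTraceOfInvariants_neg (c₆ Δ : ℚ) :
    untwistedTraceOfInvariants (-c₆) Δ = -untwistedTraceOfInvariants c₆ Δ := by
  have h := res9_mem_Ico c₆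
  unfold untwistedTraceOfInvariants
  rw [res9_neg, signNine_neg_emod_of_mem h.1 h.2, traceTableIV_neg_emod_of_mem h.1 h.2]
  split_ifs <;> ring

/-- **`a(−27c₆, 729Δ) = a(c₆, Δ)`** for `Δ ≠ 0`: the `χ₋₃`-twist at the level of invariants (`c₆ ↦ (−3)³c₆`,
`Δ ↦ (−3)⁶Δ`; `v₃Δ ↦ v₃Δ + 6` swaps the branches `4 ↔ 10`, `6 ↔ 0 (mod 12)`, and `c₆' ↦ −c₆'` flips `s`, `T`: the two
sign changes cancel). [cite: Kraus1990, Théorème (p = 3)] -/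
theorem untwistedTraceOfInvariants_negTwentySeven_mul (c₆ : ℚ) {Δ : ℚ} (hΔ : Δ ≠ 0) :
    untwistedTraceOfInvariants (-27 * c₆) (729 * Δ) = untwistedTraceOfInvariants c₆ Δ := by
  have h := res9_mem_Ico c₆
  have h6 : Rizzo.res9 (-27 * c₆) = (-Rizzo.res9 c₆) % 9 := by
    rw [show (-27 : ℚ) * c₆ = -(3 ^ 3 * c₆) by ring, res9_neg, res9_three_pow_mul]
  have hΔ9 : Rizzo.res9 (729 * Δ) = Rizzo.res9 Δ := by
    rw [show (729 : ℚ) = 3 ^ 6 by norm_num, res9_three_pow_mul]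
  have hv : padicValRat 3 (729 * Δ) = padicValRat 3 Δ + 6 := by
    have h33 : padicValRat 3 (3 : ℚ) = 1 := by
      have := @padicValRat.self 3 (by norm_num)
      simpa using this
    rw [show (729 : ℚ) = 3 ^ 6 by norm_num, padicValRat.mul (pow_ne_zero _ (by norm_num)) hΔ, padicValRat.pow, h33]
    ring
  unfold untwistedTraceOfInvariants
  rw [h6, hΔ9, hv, signNine_neg_emod_of_mem h.1 h.2, traceTableIV_neg_emod_of_mem h.1 h.2]
  set v := padicValRat 3 Δ
  have h12 : (v + 6) % 12 = 4 ∧ v % 12 = 10 ∨ (v + 6) % 12 = 10 ∧ v % 12 = 4 ∨ (v + 6) % 12 = 6 ∧ v % 12 = 0 ∨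
      (v + 6) % 12 = 0 ∧ v % 12 = 6 ∨
      ((v + 6) % 12 ≠ 4 ∧ (v + 6) % 12 ≠ 10 ∧ (v + 6) % 12 ≠ 6 ∧ (v + 6) % 12 ≠ 0 ∧
        v % 12 ≠ 4 ∧ v % 12 ≠ 10 ∧ v % 12 ≠ 6 ∧ v % 12 ≠ 0) := by omega
  rcases h12 with ⟨ha, hb⟩ | ⟨ha, hb⟩ | ⟨ha, hb⟩ | ⟨ha, hb⟩ | ⟨h1, h2, h3, h4, h5, h6', h7, h8⟩
  · simp [ha, hb]
  · simp [ha, hb]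
  · simp [ha, hb]
  · simp [ha, hb]
  · simp [h1, h2, h3, h4, h5, h6', h7, h8]

end ClosedForm

/-! ### Quadratic twists of a Weierstrass equation -/

section Twist

variable (W : WeierstrassCurve ℚ)

/-- **`a_w(W^{(−1)}) = −a_w(W)`** for every equation `W` over `ℚ` (`c₆(W^{(−1)}) = −c₆`, `Δ(W^{(−1)}) = Δ`).
[cite: SilvermanAEC2009, X.2 Prop. 2.4] [cite: Kraus1990, Théorème (p = 3)] -/
theorem psUntwistedTrace_quadraticTwist_neg_one :
    (W.quadraticTwist (-1)).psUntwistedTrace = -W.psUntwistedTrace := by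
  rw [psUntwistedTrace_def, psUntwistedTrace_def, quadraticTwist_c₆, quadraticTwist_Δ]
  norm_num
  exact untwistedTraceOfInvariants_neg W.c₆ W.Δ

/-- **`a_w(W^{(−3)}) = a_w(W)`** for every equation `W` over `ℚ` with `Δ ≠ 0` — the `χ₋₃`-partner has the same
untwisted trace («one untwist newform per `χ₋₃`-pair», LAW L-tw3), now for the closed form on any model.
[cite: SilvermanAEC2009, X.2 Prop. 2.4] [cite: Kraus1990, Théorème (p = 3)] -/
theorem psUntwistedTrace_quadraticTwist_neg_three (hΔ : W.Δ ≠ 0) :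
    (W.quadraticTwist (-3)).psUntwistedTrace = W.psUntwistedTrace := by
  rw [psUntwistedTrace_def, psUntwistedTrace_def, quadraticTwist_c₆, quadraticTwist_Δ]
  norm_num
  rw [show -((27 : ℚ) * W.c₆) = -27 * W.c₆ by ring]
  exact untwistedTraceOfInvariants_negTwentySeven_mul W.c₆ hΔ

/-- **`a_w(W^{(3)}) = −a_w(W)`** for every equation `W` over `ℚ` with `Δ ≠ 0` (`27c₆ = −(−27c₆)`: the `χ₃`-twist is
the `χ₋₁`-twist of the `χ₋₃`-partner). [cite: SilvermanAEC2009, X.2 Prop. 2.4] [cite: Kraus1990, Théorème (p = 3)] -/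
theorem psUntwistedTrace_quadraticTwist_three (hΔ : W.Δ ≠ 0) :
    (W.quadraticTwist 3).psUntwistedTrace = -W.psUntwistedTrace := by
  rw [psUntwistedTrace_def, psUntwistedTrace_def, quadraticTwist_c₆, quadraticTwist_Δ]
  norm_num
  rw [show (27 : ℚ) * W.c₆ = -(-27 * W.c₆) by ring, untwistedTraceOfInvariants_neg,
    untwistedTraceOfInvariants_negTwentySeven_mul W.c₆ hΔ]

end Twist

end Summit.BirchSwinnertonDyer.BirchSwinnertonDyer.Theorems.PSUntwistedTrace
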